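import Summits.CriticalPhenomena.CardyFormulaZ2.Theorems.CardyAnchoredRigidityCardyShadowIsolatedDilationDynamicsGlue
import Summits.CriticalPhenomena.CardyFormulaZ2.Theorems.CardySelfRefinementTwoLagsAllLags
import HarnessLib

/-!
# Crux `CardyShadowIsolated` (stmt-CriticalPhenomena-5767): the lag-invariance reduction

The crux (shared verbatim by routes CardyLocalRigidity / CardyAnchoredRigidity): if the Cardy
shadow `g_F` is a product-space cluster point of the bond-`ℤ²` crossing functions
`δ ↦ (R ↦ bondDomainCrossingProb R δ)` as `δ → 0⁺`, then `g_F` is an isolated point of the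
cluster set `Λ' = clusterSet`.

This file lands, as tree theorems attached to the crux, the *moving / fixed dichotomy* of the
dilation flow on `Λ'` (line `lag-invariance` of strategist s3, whose sorry-free lemmas are
adapted here; the two stubs of that line are registered on the item as
`stub_latticeTwoLags` (S1) and `stub_cardyIsolatedAmongFixed` (S2), and enter below VERBATIM as
hypotheses — no `Prop` handles):

* **S1 ⇒ `Λ'` is pointwise dilation-fixed.**  If halving and thirding the mesh changes no
  crossing probability asymptotically (`P_{δ/2}(R) − P_δ(R) → 0`, `P_{δ/3}(R) − P_δ(R) → 0` for
  every conformal rectangle `R`), then every cluster point is fixed by `scaleAct (log 2)` and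
  `scaleAct (log 3)` (a cluster value of a null function is `0`; exact lattice covariance
  `bondDomainCrossingProb_map_dilation`), hence by every `scaleAct s`: the stabiliser is a closed
  additive subgroup of `ℝ` (joint continuity of the flow on `Λ'`, `continuous_scaleActOn`) that
  is not cyclic (`log 2 / log 3 ∉ ℚ`, `int_mul_log_two_eq_int_mul_log_three`), hence dense
  (`AddSubgroup.dense_or_cyclic`), hence all of `ℝ`.
* **Pointwise fixedness retires the lead's stubs D and E and reduces C to S2**: a constant orbit
  converging to `g_F` is `g_F` (`cardyUnstableTrivial_of_scaleFixed`,
  `cardyStableTrivial_of_scaleFixed`, conclusions = the registered stubs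
  `stub_cardyUnstableTrivial` / `stub_cardyStableTrivial` verbatim), and "the whole orbit stays in
  `N`" becomes "`g' ∈ N`" (`cardyIsolatedInvariant_of_scaleFixed_of_isolatedAmongFixed`).
  Conversely C ⇒ S2 and crux ⇒ S2 unconditionally.
* **Composition**: S1 → S2 → crux BY NAME for both route decls
  (`CardyShadowIsolated_of_latticeTwoLags_of_isolatedAmongFixed`, `…_local`).

So the open residual of the crux can be read either as C ∧ D (Butler–Waltman glue, file
`…DilationDynamicsGlue`) or as S1 ∧ S2 (this file); S1 is the conformal-rectangle shadow of
`CardySelfRefinement.ScaleInvariantLimits` (stmt-CriticalPhenomena-10265) and S2 is strictly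
weaker than the crux.  All three of S1, S2 and the crux are implied by `CardyFormulaZ2`; none is
proved here.

References: V. Beffara, *Is critical 2D percolation universal?*, Progr. Probab. 60 (2008),
arXiv:0708.3908, §5 (mesh refinement inside one FKG family; the missing `o(δ²)` pivotal
estimate); O. Schramm, S. Smirnov, Ann. Probab. 39 (2011), arXiv:1101.5820, §1 (subsequential
limits for bond-`ℤ²`); H. Duminil-Copin, K. K. Kozlowski, D. Krachun, I. Manolescu, M. Oulamara,
arXiv:2012.11672, §1.1 (rotation invariance proved, scaling step open); S. Smirnov, C. R. Acad.
Sci. 333 (2001), Thm 1.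
-/

noncomputable section

namespace Summit.CriticalPhenomena.CardyFormulaZ2.Theorems.CardyShadowIsolated.LagInvariance

open Set Filter Topology
open Literature.Probability.RandomPlanarGeometry Literature.Probability.Percolation
open Summit.CriticalPhenomena.CardyFormulaZ2.Theorems.CardyShadowIsolated.DilationDynamics

/-! ### One lag ⇒ one fixed dilation on all of `Λ'` -/

/-- A real cluster value of a function tending to `0` is `0`. [folklore] -/
theorem eq_zero_of_mapClusterPt_of_tendsto_zero {α : Type*} {F : Filter α} {u : α → ℝ} {y : ℝ}
    (hy : MapClusterPt y F u) (hu : Tendsto u F (𝓝 0)) : y = 0 :=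
  eq_of_nhds_neBot (hy.clusterPt.mono hu).neBot

/-- **One lag at the level of cluster points.**  If `P_{δ/k}(R) − P_δ(R) → 0` for every `R`
(`k > 0`), then every cluster point is fixed by the dilation `e^{log k}`: the pair evaluation
`f ↦ f(kR) − f(R)` is continuous on the product space, `P_δ(kR) = P_{δ/k}(R)` exactly
(`bondDomainCrossingProb_map_dilation`), and a cluster value of a null function is `0`.
(Adapted from strategist s3's `Lines/lag_invariance.lean`.) [cite: SchrammSmirnov2011, §1] -/
theorem scaleAct_log_eq_self_of_lag {g : ConformalRectangle → ℝ} (hg : g ∈ clusterSet)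
    {k : ℝ} (hk : 0 < k)
    (hlag : ∀ R : ConformalRectangle,
      Tendsto (fun δ : ℝ => bondDomainCrossingProb R (δ / k) - bondDomainCrossingProb R δ)
        (nhdsWithin (0 : ℝ) (Set.Ioi 0)) (𝓝 0)) :
    scaleAct (Real.log k) g = g := by
  funext R
  have hg' : MapClusterPt g (nhdsWithin (0 : ℝ) (Set.Ioi 0))
      (fun (δ : ℝ) (R : ConformalRectangle) => bondDomainCrossingProb R δ) := hg
  have hev : Continuous fun f : ConformalRectangle → ℝ => f (R.map (dilation (Real.log k))) - f R :=
    (continuous_apply _).sub (continuous_apply _)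
  have h1 : MapClusterPt (g (R.map (dilation (Real.log k))) - g R) (nhdsWithin (0 : ℝ) (Set.Ioi 0))
      ((fun f : ConformalRectangle → ℝ => f (R.map (dilation (Real.log k))) - f R) ∘
        fun (δ : ℝ) (R : ConformalRectangle) => bondDomainCrossingProb R δ) :=
    hg'.continuousAt_comp hev.continuousAt
  have h2 : ((fun f : ConformalRectangle → ℝ => f (R.map (dilation (Real.log k))) - f R) ∘
        fun (δ : ℝ) (R : ConformalRectangle) => bondDomainCrossingProb R δ) =
      fun δ : ℝ => bondDomainCrossingProb R (δ / k) - bondDomainCrossingProb R δ := by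
    funext δ
    simp only [Function.comp_apply]
    rw [bondDomainCrossingProb_map_dilation, Real.exp_neg, Real.exp_log hk, inv_mul_eq_div]
  rw [h2] at h1
  have h3 : g (R.map (dilation (Real.log k))) - g R = 0 :=
    eq_zero_of_mapClusterPt_of_tendsto_zero h1 (hlag R)
  show g (R.map (dilation (Real.log k))) = g R
  linarith

/-! ### Two fixed dilations ⇒ all (closed subgroup argument) -/

/-- The orbit map `s ↦ scaleAct s g` of a cluster point is continuous into the product space
(joint continuity of the dilation flow on `Λ'`, `continuous_scaleActOn`). [cite: SchrammSmirnov2011, §1] -/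
theorem continuous_scaleAct_of_mem {g : ConformalRectangle → ℝ} (hg : g ∈ clusterSet) :
    Continuous fun s : ℝ => scaleAct s g := by
  have h1 : Continuous fun s : ℝ => (scaleActOn s ⟨g, hg⟩ : ↥clusterSet) :=
    continuous_scaleActOn.comp (continuous_id.prodMk continuous_const)
  exact continuous_subtype_val.comp h1

/-- **Two lags give all lags** at the level of one cluster point: the stabiliser
`{s | scaleAct s g = g}` is a closed additive subgroup of `ℝ` containing `log 2` and `log 3`;
`log 2 / log 3 ∉ ℚ` (`int_mul_log_two_eq_int_mul_log_three`, parity of `2ⁿ = 3ᵐ`) makes it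
non-cyclic, hence dense (`AddSubgroup.dense_or_cyclic`), hence everything.
(Adapted from strategist s3's `Lines/lag_invariance.lean`.) [cite: Beffara2008Universal, §5] -/
theorem scaleAct_eq_self_of_two_three {g : ConformalRectangle → ℝ} (hg : g ∈ clusterSet)
    (h2 : scaleAct (Real.log 2) g = g) (h3 : scaleAct (Real.log 3) g = g) (s : ℝ) :
    scaleAct s g = g := by
  let H : AddSubgroup ℝ :=
    { carrier := {x | scaleAct x g = g}
      add_mem' := by
        intro x y hx hy
        simp only [mem_setOf_eq] at hx hy ⊢
        rw [scaleAct_add, hy, hx]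
      zero_mem' := by
        simp only [mem_setOf_eq]
        exact scaleAct_zero g
      neg_mem' := by
        intro x hx
        simp only [mem_setOf_eq] at hx ⊢
        have h : scaleAct (-x) (scaleAct x g) = g := by
          rw [← scaleAct_add, neg_add_cancel, scaleAct_zero]
        rwa [hx] at h }
  have hmem : ∀ {x : ℝ}, x ∈ H ↔ scaleAct x g = g := fun {x} => Iff.rfl
  have hclosed : IsClosed (H : Set ℝ) :=
    isClosed_eq (continuous_scaleAct_of_mem hg) continuous_const
  have hlog2 : Real.log 2 ∈ H := hmem.2 h2
  have hlog3 : Real.log 3 ∈ H := hmem.2 h3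
  have hdense : Dense (H : Set ℝ) := by
    rcases AddSubgroup.dense_or_cyclic H with hd | ⟨a, ha⟩
    · exact hd
    · exfalso
      rw [ha, AddSubgroup.mem_closure_singleton] at hlog2 hlog3
      obtain ⟨m, hm⟩ := hlog2
      obtain ⟨n, hn⟩ := hlog3
      have key : (n : ℝ) * Real.log 2 = (m : ℝ) * Real.log 3 := by
        rw [← hm, ← hn, zsmul_eq_mul, zsmul_eq_mul]; ring
      have hn0 : n = 0 :=
        Summit.CriticalPhenomena.CardyFormulaZ2.Theorems.int_mul_log_two_eq_int_mul_log_three key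
      rw [hn0, zero_zsmul] at hn
      exact (Real.log_pos (by norm_num : (1 : ℝ) < 3)).ne' hn.symm
  have hall : (H : Set ℝ) = univ := by
    rw [← hclosed.closure_eq]; exact hdense.closure_eq
  have hs : s ∈ (H : Set ℝ) := by rw [hall]; exact mem_univ _
  exact hs

/-- **S1 ⇒ every cluster point is invariant under every dilation** (the conformal-rectangle
shadow of `ScaleInvariantLimits`, from the two lattice lags; hypothesis = the registered stub
`stub_latticeTwoLags` verbatim). [cite: Beffara2008Universal, §5] -/
theorem scaleAct_eq_self_of_latticeTwoLags
    (hS1 : ∀ R : ConformalRectangle,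
      Tendsto (fun δ : ℝ => bondDomainCrossingProb R (δ / 2) - bondDomainCrossingProb R δ)
          (nhdsWithin (0 : ℝ) (Set.Ioi 0)) (𝓝 0) ∧
        Tendsto (fun δ : ℝ => bondDomainCrossingProb R (δ / 3) - bondDomainCrossingProb R δ)
          (nhdsWithin (0 : ℝ) (Set.Ioi 0)) (𝓝 0)) :
    ∀ g ∈ clusterSet, ∀ s : ℝ, scaleAct s g = g := by
  intro g hg s
  have h2 : scaleAct (Real.log 2) g = g :=
    scaleAct_log_eq_self_of_lag hg two_pos fun R => (hS1 R).1
  have h3 : scaleAct (Real.log 3) g = g :=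
    scaleAct_log_eq_self_of_lag hg three_pos fun R => (hS1 R).2
  exact scaleAct_eq_self_of_two_three hg h2 h3 s

/-! ### Pointwise fixedness retires D and E and reduces C to S2 -/

/-- **Scale-fixed `Λ'` ⇒ D** (`stub_cardyUnstableTrivial` of the lead's skeleton, verbatim as
conclusion): a fixed point whose backward orbit converges to `g` is `g`. [folklore] -/
theorem cardyUnstableTrivial_of_scaleFixed (hInv : ∀ g ∈ clusterSet, ∀ s : ℝ, scaleAct s g = g) :
    ∀ g : ConformalRectangle → ℝ, IsCardyShadow g → ∀ g' ∈ clusterSet,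
      Tendsto (fun s : ℝ => scaleAct s g') atBot (𝓝 g) → g' = g := by
  intro g _ g' hg' ht
  have hconst : (fun s : ℝ => scaleAct s g') = fun _ => g' := funext fun s => hInv g' hg' s
  rw [hconst] at ht
  exact tendsto_nhds_unique tendsto_const_nhds ht

/-- **Scale-fixed `Λ'` ⇒ E** (`stub_cardyStableTrivial` of the lead's skeleton, verbatim as
conclusion). [folklore] -/
theorem cardyStableTrivial_of_scaleFixed (hInv : ∀ g ∈ clusterSet, ∀ s : ℝ, scaleAct s g = g) :
    ∀ g : ConformalRectangle → ℝ, IsCardyShadow g → ∀ g' ∈ clusterSet,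
      Tendsto (fun s : ℝ => scaleAct s g') atTop (𝓝 g) → g' = g := by
  intro g _ g' hg' ht
  have hconst : (fun s : ℝ => scaleAct s g') = fun _ => g' := funext fun s => hInv g' hg' s
  rw [hconst] at ht
  exact tendsto_nhds_unique tendsto_const_nhds ht

/-- **Scale-fixed `Λ'` ∧ S2 ⇒ C** (`stub_cardyIsolatedInvariant` of the lead's skeleton,
verbatim as conclusion; S2 = `stub_cardyIsolatedAmongFixed` verbatim as hypothesis): with all of
`Λ'` fixed, "the whole orbit of `g'` stays in `N`" is just "`g' ∈ N`". [folklore] -/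
theorem cardyIsolatedInvariant_of_scaleFixed_of_isolatedAmongFixed
    (hInv : ∀ g ∈ clusterSet, ∀ s : ℝ, scaleAct s g = g)
    (hS2 : ∀ g : ConformalRectangle → ℝ, IsCardyShadow g → g ∈ clusterSet →
      ∃ N ∈ 𝓝 g, ∀ g' ∈ clusterSet, g' ∈ N → (∀ s : ℝ, scaleAct s g' = g') → g' = g) :
    ∀ g : ConformalRectangle → ℝ, IsCardyShadow g → g ∈ clusterSet →
      ∃ N ∈ 𝓝 g, ∀ g' ∈ clusterSet, (∀ s : ℝ, scaleAct s g' ∈ N) → g' = g := by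
  intro g hsh hg
  obtain ⟨N, hN, hsep⟩ := hS2 g hsh hg
  refine ⟨N, hN, fun g' hg' horb => hsep g' hg' ?_ (hInv g' hg')⟩
  have h0 := horb 0
  rwa [scaleAct_zero] at h0

/-- **C ⇒ S2** unconditionally: a fixed competitor inside the isolating neighbourhood has its
whole (constant) orbit inside it. [folklore] -/
theorem isolatedAmongFixed_of_cardyIsolatedInvariant
    (hC : ∀ g : ConformalRectangle → ℝ, IsCardyShadow g → g ∈ clusterSet →
      ∃ N ∈ 𝓝 g, ∀ g' ∈ clusterSet, (∀ s : ℝ, scaleAct s g' ∈ N) → g' = g) :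
    ∀ g : ConformalRectangle → ℝ, IsCardyShadow g → g ∈ clusterSet →
      ∃ N ∈ 𝓝 g, ∀ g' ∈ clusterSet, g' ∈ N → (∀ s : ℝ, scaleAct s g' = g') → g' = g := by
  intro g hsh hg
  obtain ⟨N, hN, hsep⟩ := hC g hsh hg
  refine ⟨N, hN, fun g' hg' hg'N hfix => hsep g' hg' fun s => ?_⟩
  rw [hfix s]
  exact hg'N

/-- **The crux ⇒ S2** (S2 is a genuine weakening of the crux; S1 carries the difference).
[folklore] -/
theorem isolatedAmongFixed_of_cardyShadowIsolated
    (h : Summit.CriticalPhenomena.CardyFormulaZ2.Theses.CardyLocalRigidity.CardyShadowIsolated) :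
    ∀ g : ConformalRectangle → ℝ, IsCardyShadow g → g ∈ clusterSet →
      ∃ N ∈ 𝓝 g, ∀ g' ∈ clusterSet, g' ∈ N → (∀ s : ℝ, scaleAct s g' = g') → g' = g := by
  intro g hsh hg
  obtain ⟨U, hU, hsep⟩ := h g hsh hg
  exact ⟨U, hU, fun g' hg' hg'U _ => hsep g' hg'U hg'⟩

/-! ### The composition: scale-fixed `Λ'` (or S1) → S2 → crux, by name, for both route decls -/

/-- **Scale invariance of `Λ'` plus isolation among fixed points give the crux** (route
CardyLocalRigidity, the primary route of the shared item): the isolating neighbourhood is the `N`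
of S2. [folklore] -/
theorem CardyShadowIsolated_local_of_scaleFixed_of_isolatedAmongFixed
    (hInv : ∀ g ∈ clusterSet, ∀ s : ℝ, scaleAct s g = g)
    (hS2 : ∀ g : ConformalRectangle → ℝ, IsCardyShadow g → g ∈ clusterSet →
      ∃ N ∈ 𝓝 g, ∀ g' ∈ clusterSet, g' ∈ N → (∀ s : ℝ, scaleAct s g' = g') → g' = g) :
    Summit.CriticalPhenomena.CardyFormulaZ2.Theses.CardyLocalRigidity.CardyShadowIsolated := by
  intro g hshadow hg
  obtain ⟨N, hN, hsep⟩ := hS2 g hshadow hg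
  exact ⟨N, hN, fun g' hg'N hg' => hsep g' hg' hg'N (hInv g' hg')⟩

/-- The same for the sibling route decl (route CardyAnchoredRigidity). [folklore] -/
theorem CardyShadowIsolated_of_scaleFixed_of_isolatedAmongFixed
    (hInv : ∀ g ∈ clusterSet, ∀ s : ℝ, scaleAct s g = g)
    (hS2 : ∀ g : ConformalRectangle → ℝ, IsCardyShadow g → g ∈ clusterSet →
      ∃ N ∈ 𝓝 g, ∀ g' ∈ clusterSet, g' ∈ N → (∀ s : ℝ, scaleAct s g' = g') → g' = g) :
    Summit.CriticalPhenomena.CardyFormulaZ2.Theses.CardyAnchoredRigidity.CardyShadowIsolated := by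
  intro g hshadow hg
  obtain ⟨N, hN, hsep⟩ := hS2 g hshadow hg
  exact ⟨N, hN, fun g' hg'N hg' => hsep g' hg' hg'N (hInv g' hg')⟩

/-- **S1 → S2 → crux** by name (route CardyLocalRigidity); hypotheses = the registered stubs
`stub_latticeTwoLags`, `stub_cardyIsolatedAmongFixed` verbatim. [folklore] -/
theorem CardyShadowIsolated_local_of_latticeTwoLags_of_isolatedAmongFixed
    (hS1 : ∀ R : ConformalRectangle,
      Tendsto (fun δ : ℝ => bondDomainCrossingProb R (δ / 2) - bondDomainCrossingProb R δ)
          (nhdsWithin (0 : ℝ) (Set.Ioi 0)) (𝓝 0) ∧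
        Tendsto (fun δ : ℝ => bondDomainCrossingProb R (δ / 3) - bondDomainCrossingProb R δ)
          (nhdsWithin (0 : ℝ) (Set.Ioi 0)) (𝓝 0))
    (hS2 : ∀ g : ConformalRectangle → ℝ, IsCardyShadow g → g ∈ clusterSet →
      ∃ N ∈ 𝓝 g, ∀ g' ∈ clusterSet, g' ∈ N → (∀ s : ℝ, scaleAct s g' = g') → g' = g) :
    Summit.CriticalPhenomena.CardyFormulaZ2.Theses.CardyLocalRigidity.CardyShadowIsolated :=
  CardyShadowIsolated_local_of_scaleFixed_of_isolatedAmongFixed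
    (scaleAct_eq_self_of_latticeTwoLags hS1) hS2

/-- **S1 → S2 → crux** by name (route CardyAnchoredRigidity). [folklore] -/
theorem CardyShadowIsolated_of_latticeTwoLags_of_isolatedAmongFixed
    (hS1 : ∀ R : ConformalRectangle,
      Tendsto (fun δ : ℝ => bondDomainCrossingProb R (δ / 2) - bondDomainCrossingProb R δ)
          (nhdsWithin (0 : ℝ) (Set.Ioi 0)) (𝓝 0) ∧
        Tendsto (fun δ : ℝ => bondDomainCrossingProb R (δ / 3) - bondDomainCrossingProb R δ)
          (nhdsWithin (0 : ℝ) (Set.Ioi 0)) (𝓝 0))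
    (hS2 : ∀ g : ConformalRectangle → ℝ, IsCardyShadow g → g ∈ clusterSet →
      ∃ N ∈ 𝓝 g, ∀ g' ∈ clusterSet, g' ∈ N → (∀ s : ℝ, scaleAct s g' = g') → g' = g) :
    Summit.CriticalPhenomena.CardyFormulaZ2.Theses.CardyAnchoredRigidity.CardyShadowIsolated :=
  CardyShadowIsolated_of_scaleFixed_of_isolatedAmongFixed
    (scaleAct_eq_self_of_latticeTwoLags hS1) hS2

/-! ### Registered stub of the lead's skeleton: the lag-invariance glue -/

/-- **`stub_lagInvarianceGlue`** (registered on stmt-CriticalPhenomena-5767): S1 → S2 → crux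
(route CardyAnchoredRigidity), the lag-invariance composition with both stubs verbatim as
hypotheses. [folklore] -/
theorem stub_lagInvarianceGlue :
    (∀ R : Literature.Probability.RandomPlanarGeometry.ConformalRectangle,
      Filter.Tendsto (fun δ : ℝ => Literature.Probability.Percolation.bondDomainCrossingProb R (δ / 2) -
          Literature.Probability.Percolation.bondDomainCrossingProb R δ)
        (nhdsWithin (0 : ℝ) (Set.Ioi 0)) (nhds 0) ∧
      Filter.Tendsto (fun δ : ℝ => Literature.Probability.Percolation.bondDomainCrossingProb R (δ / 3) -
          Literature.Probability.Percolation.bondDomainCrossingProb R δ)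
        (nhdsWithin (0 : ℝ) (Set.Ioi 0)) (nhds 0)) →
    (∀ g : Literature.Probability.RandomPlanarGeometry.ConformalRectangle → ℝ,
      Summit.CriticalPhenomena.CardyFormulaZ2.Theorems.CardyShadowIsolated.DilationDynamics.IsCardyShadow g →
      g ∈ Summit.CriticalPhenomena.CardyFormulaZ2.Theorems.CardyShadowIsolated.DilationDynamics.clusterSet →
      ∃ N ∈ nhds g,
        ∀ g' ∈ Summit.CriticalPhenomena.CardyFormulaZ2.Theorems.CardyShadowIsolated.DilationDynamics.clusterSet,
          g' ∈ N →
          (∀ s : ℝ,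
            Summit.CriticalPhenomena.CardyFormulaZ2.Theorems.CardyShadowIsolated.DilationDynamics.scaleAct s g' = g') →
          g' = g) →
    Summit.CriticalPhenomena.CardyFormulaZ2.Theses.CardyAnchoredRigidity.CardyShadowIsolated :=
  fun hS1 hS2 => CardyShadowIsolated_of_latticeTwoLags_of_isolatedAmongFixed hS1 hS2

end Summit.CriticalPhenomena.CardyFormulaZ2.Theorems.CardyShadowIsolated.LagInvariance

end
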